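import Summits.AtomisticToContinuum.HydrodynamicLimit.Theorems.LambertianContactSwapLambertianEulerPairGraphMoments
import Summits.AtomisticToContinuum.HydrodynamicLimit.Theorems.LambertianContactSwapLambertianEulerGibbsInsertionZip
import HarnessLib

/-!
# Moments of a shell-pair count: combinatorics and term-by-term integration
# (`LambertianContactSwap.LambertianEuler`, stmt-AtomisticToContinuum-11854, line `Sketch`; lead c10,
# wave 2, piece W8 `ShellCountTail`, part 1 of 2: registered stub `lintegral_card_filter_pow_le`)

Support file (`--supports stmt-AtomisticToContinuum-11854`).  The `k`-th moments of the STATIC SHELL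
COUNT `F_δ(y)` (number of ordered pairs `i ≠ j` with `ε ≤ d(x_i, x_j) ≤ ε + δ ‖v_i − v_j‖`) of lead
c10's concentration theorem are controlled by matchings and stars; this file proves the pointwise
combinatorics and the abstract term-by-term integration, part 2 (`…ShellCountTail`) plugs in the
landed free-law estimates and derives the `N`-uniform upper tail.

* POINTWISE (`card_filter_pow_le`): from the landed `…PairGraphMoments.card_pow_le_aux`
  (`F^k ≤ M_k + 2k² F^{k-1} D`, `M_k` = number of ordered `k`-tuples of pairwise vertex-disjoint pairs,
  `D` = maximal degree) and the case split `4k² D ≤ F` / `F < 4k² D`: `F^k ≤ 2 M_k + (4k²)^k D^k`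
  (`pow_le_of_matching_rec`); `D^k ≤ Σ_a deg_a^k`; `deg^k ≤ k^k (1 + k! C(deg, k))`
  (`pow_le_mul_one_add_choose`, from `(n + 1 - k)^k ≤ n (n-1) ⋯ (n-k+1)`), and `C(deg_a, k)` is at
  most the number of `k`-sets `B ∌ a` all of whose members are partners of `a`
  (`choose_card_filter_le`).  Hence
  `F^k ≤ 2 Σ_{t disjoint} 𝟙{∀ l, P (t l)} + (4k²)^k Σ_a (k^k + k^k k! Σ_{|B| = k} 𝟙{∀ b ∈ B, P (a, b)})`.
* EXPECTATION (`lintegral_card_filter_pow_le`, for an abstract measurable symmetric irreflexive random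
  pair relation `P` under a probability measure): exchanging `∫⁻` with the finite sums,
  `E[F^k] ≤ 2 (n+1)^{2k} Mb + (4k²)^k (n+1) k^k (1 + k! C(n, k) Tb)` whenever the `k`-matching events
  have probability `≤ Mb` and the `k`-star events probability `≤ Tb`.
* GIBBS PROBABILITY OF A MATCHING OF SHELLS (`localGibbsLaw_matchingShells_le`): the event depends on
  the `≤ 2k` particles of the matching, so the insertion bound
  `…GibbsInsertionZip.localGibbsLaw_le_pow_mul_pi` (`G ≤ 2^{|I|} U`) turns a free-law bound `U ≤ P^k`
  into `G ≤ 4^k P^k` (`measurableSet_shell` for the measurability of one shell).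

References: the matching/star decomposition of moments of pair counts (`U`-statistics),
Janson–Łuczak–Ruciński, *Random Graphs*, §6.1; insertion bounds in the canonical ensemble,
Pulvirenti–Tsagkarogiannis 2012, §3.  All statements [folklore].
-/

noncomputable section

namespace Summit.AtomisticToContinuum.HydrodynamicLimit.Theorems.LambertianContactSwapLambertianEulerShellCountMoments

open scoped BigOperators Topology ENNReal InnerProductSpace
open MeasureTheory ProbabilityTheory Filter Set
open Literature.MathematicalPhysics.KineticTheory Literature.MathematicalPhysics.StatisticalMechanics
open Literature.Analysis.FluidPDE
open Summit.AtomisticToContinuum.HydrodynamicLimit.Theorems.LambertianContactSwapLambertianEulerPairGraphMoments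
open Summit.AtomisticToContinuum.HydrodynamicLimit.Theorems.LambertianContactSwapLambertianEulerGibbsInsertionZip

/-! ## Pointwise combinatorics -/

/-- The arithmetic of the case split: from `F^k ≤ M + 2k² F^{k-1} D` and `D^k ≤ S` conclude
`F^k ≤ 2M + (4k²)^k S` (if `4k² D ≤ F` the correction is at most `F^k / 2`, otherwise
`F^k ≤ (4k² D)^k`). [folklore] -/
theorem pow_le_of_matching_rec {F k M D S : ℕ} (h0 : F ^ k ≤ M + 2 * k ^ 2 * F ^ (k - 1) * D)
    (hDk : D ^ k ≤ S) : F ^ k ≤ 2 * M + (4 * k ^ 2) ^ k * S := by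
  by_cases hc : 4 * k ^ 2 * D ≤ F
  · have h1 : 2 * (2 * k ^ 2 * F ^ (k - 1) * D) ≤ F ^ k := by
      cases k with
      | zero => simp
      | succ j =>
        calc 2 * (2 * (j + 1) ^ 2 * F ^ (j + 1 - 1) * D) = 4 * (j + 1) ^ 2 * D * F ^ j := by
              rw [Nat.add_sub_cancel]; ring
          _ ≤ F * F ^ j := Nat.mul_le_mul_right _ hc
          _ = F ^ (j + 1) := (pow_succ' _ _).symm
    calc F ^ k ≤ 2 * M := by omega
      _ ≤ _ := Nat.le_add_right _ _
  · push Not at hc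
    calc F ^ k ≤ (4 * k ^ 2 * D) ^ k := Nat.pow_le_pow_left hc.le k
      _ = (4 * k ^ 2) ^ k * D ^ k := mul_pow _ _ _
      _ ≤ (4 * k ^ 2) ^ k * S := Nat.mul_le_mul_left _ hDk
      _ ≤ _ := Nat.le_add_left _ _

/-- `F^k ≤ 2 M_k + (4k²)^k Σ_a deg_a^k` for a symmetric set `E` of ordered pairs of `Fin (n + 1)`
(`card_pow_le_aux`, `pow_le_of_matching_rec` and `D^k ≤ Σ_a deg_a^k`, the maximum being attained).
[folklore] -/
theorem pow_le_two_mul_add {n : ℕ} (E : Finset (Fin (n + 1) × Fin (n + 1)))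
    (hsym : ∀ p ∈ E, p.swap ∈ E) (k : ℕ) :
    E.card ^ k ≤
      2 * ((Finset.univ : Finset (Fin k → Fin (n + 1) × Fin (n + 1))).filter (fun t => (∀ l, t l ∈ E) ∧
          ∀ l l', l ≠ l' → Disjoint ({(t l).1, (t l).2} : Finset (Fin (n + 1))) {(t l').1, (t l').2})).card +
        (4 * k ^ 2) ^ k * ∑ a, (E.filter (fun p => p.1 = a)).card ^ k := by
  refine pow_le_of_matching_rec (card_pow_le_aux E hsym k) ?_
  obtain ⟨a, -, ha⟩ := Finset.exists_mem_eq_sup (Finset.univ : Finset (Fin (n + 1)))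
    Finset.univ_nonempty (fun a => (E.filter (fun p => p.1 = a)).card)
  rw [ha]
  exact Finset.single_le_sum (f := fun a => (E.filter (fun p => p.1 = a)).card ^ k)
    (fun _ _ => Nat.zero_le _) (Finset.mem_univ a)

/-- `n^k ≤ k^k (1 + k! · C(n, k))`: for `n < k` trivially, and for `k ≤ n` from `n ≤ k (n + 1 - k)` and
`(n + 1 - k)^k ≤ n (n - 1) ⋯ (n - k + 1) = k! · C(n, k)` (`Nat.pow_sub_le_descFactorial`). [folklore] -/
theorem pow_le_mul_one_add_choose (n k : ℕ) : n ^ k ≤ k ^ k * (1 + k.factorial * n.choose k) := by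
  rcases lt_or_ge n k with h | h
  · exact (Nat.pow_le_pow_left h.le k).trans
      (Nat.le_mul_of_pos_right _ (Nat.add_pos_left Nat.one_pos _))
  · rcases Nat.eq_zero_or_pos k with rfl | hk
    · simp
    have h1 : n ≤ k * (n + 1 - k) := by
      obtain ⟨m, rfl⟩ := Nat.exists_eq_add_of_le h
      have hm : k + m + 1 - k = m + 1 := by omega
      rw [hm]
      nlinarith
    calc n ^ k ≤ (k * (n + 1 - k)) ^ k := Nat.pow_le_pow_left h1 k
      _ = k ^ k * (n + 1 - k) ^ k := mul_pow _ _ _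
      _ ≤ k ^ k * n.descFactorial k := Nat.mul_le_mul_left _ (Nat.pow_sub_le_descFactorial n k)
      _ = k ^ k * (k.factorial * n.choose k) := by rw [Nat.descFactorial_eq_factorial_mul_choose]
      _ ≤ k ^ k * (1 + k.factorial * n.choose k) := Nat.mul_le_mul_left _ (Nat.le_add_left _ _)

/-- The out-degree of `a` in a set of ordered pairs is the number of its partners `b`, `(a, b) ∈ E`
(the bijection `p ↦ p.2`, `b ↦ (a, b)`). [folklore] -/
theorem card_filter_fst_eq {n : ℕ} (E : Finset (Fin (n + 1) × Fin (n + 1))) (a : Fin (n + 1)) :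
    (E.filter (fun p => p.1 = a)).card = (Finset.univ.filter (fun b => (a, b) ∈ E)).card := by
  refine Finset.card_nbij' (fun p => p.2) (fun b => (a, b)) (fun p hp => ?_) (fun b hb => ?_)
    (fun p hp => ?_) (fun b _ => rfl)
  · rw [Finset.mem_coe, Finset.mem_filter] at hp ⊢
    obtain ⟨hpE, rfl⟩ := hp
    exact ⟨Finset.mem_univ _, hpE⟩
  · rw [Finset.mem_coe, Finset.mem_filter] at hb ⊢
    exact ⟨hb.2, rfl⟩
  · rw [Finset.mem_coe, Finset.mem_filter] at hp
    obtain ⟨-, rfl⟩ := hp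
    rfl

/-- `C(deg_a, k)` is at most the number of `k`-subsets `B` of `univ \ {a}` all of whose members are
partners of `a` (for an irreflexive pair predicate): the `k`-subsets of the partner set are such
sets. [folklore] -/
theorem choose_card_filter_le {n : ℕ} (P : Fin (n + 1) × Fin (n + 1) → Prop) [DecidablePred P]
    (hirr : ∀ q, P q → q.1 ≠ q.2) (a : Fin (n + 1)) (k : ℕ) :
    ((Finset.univ.filter fun b => P (a, b)).card).choose k ≤
      (((Finset.univ.erase a).powersetCard k).filter (fun B => ∀ b ∈ B, P (a, b))).card := by
  rw [← Finset.card_powersetCard]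
  refine Finset.card_le_card fun B hB => ?_
  rw [Finset.mem_powersetCard] at hB
  have hP : ∀ b ∈ B, P (a, b) := fun b hb => (Finset.mem_filter.1 (hB.1 hb)).2
  refine Finset.mem_filter.2 ⟨Finset.mem_powersetCard.2 ⟨fun b hb => ?_, hB.2⟩, hP⟩
  exact Finset.mem_erase.2 ⟨fun h => hirr _ (hP b hb) (h ▸ rfl), Finset.mem_univ _⟩

/-- **Pointwise bound on the `k`-th power of a symmetric irreflexive pair count** by matchings and
stars: `F^k ≤ 2 Σ_{t vertex-disjoint} 𝟙{∀ l, P (t l)} + (4k²)^k Σ_a (k^k + k^k k! Σ_{|B| = k, a ∉ B}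
𝟙{∀ b ∈ B, P (a, b)})`. [folklore] -/
theorem card_filter_pow_le {n : ℕ} (P : Fin (n + 1) × Fin (n + 1) → Prop) [DecidablePred P]
    (hsym : ∀ q, P q → P q.swap) (hirr : ∀ q, P q → q.1 ≠ q.2) (k : ℕ) :
    (Finset.univ.filter P).card ^ k ≤
      2 * ∑ t ∈ (Finset.univ : Finset (Fin k → Fin (n + 1) × Fin (n + 1))).filter
            (fun t => ∀ l l', l ≠ l' → Disjoint ({(t l).1, (t l).2} : Finset (Fin (n + 1))) {(t l').1, (t l').2}),
          (if ∀ l, P (t l) then 1 else 0) +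
        (4 * k ^ 2) ^ k * ∑ a : Fin (n + 1), (k ^ k + k ^ k * k.factorial *
          ∑ B ∈ (Finset.univ.erase a).powersetCard k, if ∀ b ∈ B, P (a, b) then 1 else 0) := by
  set E := Finset.univ.filter P with hE
  have hmem : ∀ q, q ∈ E ↔ P q := fun q => by
    rw [hE, Finset.mem_filter]
    exact ⟨fun h => h.2, fun h => ⟨Finset.mem_univ _, h⟩⟩
  have h0 := pow_le_two_mul_add E (fun p hp => (hmem _).2 (hsym p ((hmem p).1 hp))) k
  have h1 : ((Finset.univ : Finset (Fin k → Fin (n + 1) × Fin (n + 1))).filter (fun t => (∀ l, t l ∈ E) ∧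
      ∀ l l', l ≠ l' → Disjoint ({(t l).1, (t l).2} : Finset (Fin (n + 1))) {(t l').1, (t l').2})).card =
      ∑ t ∈ (Finset.univ : Finset (Fin k → Fin (n + 1) × Fin (n + 1))).filter
            (fun t => ∀ l l', l ≠ l' → Disjoint ({(t l).1, (t l).2} : Finset (Fin (n + 1))) {(t l').1, (t l').2}),
          (if ∀ l, P (t l) then 1 else 0) := by
    rw [← Finset.card_filter, Finset.filter_filter]
    congr 1
    exact Finset.filter_congr fun t _ =>
      ⟨fun h => ⟨h.2, fun l => (hmem _).1 (h.1 l)⟩, fun h => ⟨fun l => (hmem _).2 (h.2 l), h.1⟩⟩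
  have h2 : ∀ a, (E.filter (fun p => p.1 = a)).card ^ k ≤ k ^ k + k ^ k * k.factorial *
      ∑ B ∈ (Finset.univ.erase a).powersetCard k, (if ∀ b ∈ B, P (a, b) then 1 else 0) := by
    intro a
    rw [← Finset.card_filter, card_filter_fst_eq E a]
    have hE' : (Finset.univ.filter fun b => (a, b) ∈ E) = Finset.univ.filter fun b => P (a, b) :=
      Finset.filter_congr fun b _ => hmem _
    rw [hE']
    calc (Finset.univ.filter fun b => P (a, b)).card ^ k
        ≤ k ^ k * (1 + k.factorial * ((Finset.univ.filter fun b => P (a, b)).card.choose k)) :=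
          pow_le_mul_one_add_choose _ _
      _ ≤ k ^ k * (1 + k.factorial *
          (((Finset.univ.erase a).powersetCard k).filter (fun B => ∀ b ∈ B, P (a, b))).card) :=
          Nat.mul_le_mul_left _ (Nat.add_le_add_left
            (Nat.mul_le_mul_left _ (choose_card_filter_le P hirr a k)) _)
      _ = _ := by ring
  refine h0.trans ?_
  rw [h1]
  exact Nat.add_le_add_left (Nat.mul_le_mul_left _ (Finset.sum_le_sum fun a _ => h2 a)) _

/-! ## Expectations: the abstract assembly -/

/-- `∫⁻ 𝟙{p} dG = G {p}` for a measurable event written as an `if`. [folklore] -/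
theorem lintegral_ite_eq_measure {Ω : Type*} [MeasurableSpace Ω] (G : Measure Ω) {p : Ω → Prop}
    [DecidablePred p] (hp : MeasurableSet {y | p y}) :
    ∫⁻ y, (if p y then (1 : ℝ≥0∞) else 0) ∂G = G {y | p y} := by
  rw [← lintegral_indicator_one hp]
  refine lintegral_congr fun y => ?_
  by_cases h : p y
  · rw [if_pos h, Set.indicator_of_mem (show y ∈ {y | p y} from h), Pi.one_apply]
  · rw [if_neg h, Set.indicator_of_notMem (show y ∉ {y | p y} from h)]

/-- **Moments of a random symmetric irreflexive pair relation from matching and star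
probabilities.**  If under a probability measure `G` every `k`-matching event `{∀ l, P (t l)}`
(`t` pairwise vertex-disjoint) has probability `≤ Mb` and every `k`-star event
`{∀ b ∈ B, P (a, b)}` (`|B| = k`, `a ∉ B`) has probability `≤ Tb`, then
`E_G[#{q | P q}^k] ≤ 2 (n+1)^{2k} Mb + (4k²)^k (n+1) k^k (1 + k! C(n, k) Tb)`
(`card_filter_pow_le` integrated term by term). [folklore] -/
theorem lintegral_card_filter_pow_le :
    ∀ {Ω : Type*} [MeasurableSpace Ω] (G : Measure Ω) [IsProbabilityMeasure G] {n k : ℕ}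
      (P : Fin (n + 1) × Fin (n + 1) → Ω → Prop) [∀ q y, Decidable (P q y)] {Mb Tb : ℝ≥0∞},
      (∀ q, MeasurableSet {y | P q y}) → (∀ q y, P q y → P q.swap y) → (∀ q y, P q y → q.1 ≠ q.2) →
      (∀ t : Fin k → Fin (n + 1) × Fin (n + 1),
        (∀ l l', l ≠ l' → Disjoint ({(t l).1, (t l).2} : Finset (Fin (n + 1))) {(t l').1, (t l').2}) →
          G {y | ∀ l, P (t l) y} ≤ Mb) →
      (∀ (a : Fin (n + 1)) (B : Finset (Fin (n + 1))), B ∈ (Finset.univ.erase a).powersetCard k →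
          G {y | ∀ b ∈ B, P (a, b) y} ≤ Tb) →
      ∫⁻ y, (((Finset.univ.filter fun q => P q y).card ^ k : ℕ) : ℝ≥0∞) ∂G ≤
        2 * ((((n + 1) * (n + 1)) ^ k : ℕ) * Mb) +
          (4 * (k : ℝ≥0∞) ^ 2) ^ k * ((n + 1 : ℕ) * ((k : ℝ≥0∞) ^ k *
            (1 + (k.factorial : ℝ≥0∞) * (n.choose k : ℝ≥0∞) * Tb))) := by
  intro Ω _ G _ n k P _ Mb Tb hPm hsym hirr hM hT
  set Td := (Finset.univ : Finset (Fin k → Fin (n + 1) × Fin (n + 1))).filter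
      (fun t => ∀ l l', l ≠ l' → Disjoint ({(t l).1, (t l).2} : Finset (Fin (n + 1))) {(t l').1, (t l').2})
    with hTd
  -- the pointwise bound, cast to `ℝ≥0∞`
  have hpt : ∀ y, (((Finset.univ.filter fun q => P q y).card ^ k : ℕ) : ℝ≥0∞) ≤
      2 * ∑ t ∈ Td, (if ∀ l, P (t l) y then (1 : ℝ≥0∞) else 0) +
        (4 * (k : ℝ≥0∞) ^ 2) ^ k * ∑ a : Fin (n + 1), ((k : ℝ≥0∞) ^ k + (k : ℝ≥0∞) ^ k * (k.factorial : ℝ≥0∞) *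
          ∑ B ∈ (Finset.univ.erase a).powersetCard k, if ∀ b ∈ B, P (a, b) y then (1 : ℝ≥0∞) else 0) := by
    intro y
    have h := card_filter_pow_le (fun q => P q y) (fun q hq => hsym q y hq) (fun q hq => hirr q y hq) k
    exact_mod_cast h
  -- measurability of the events and of the pieces
  have hmS : ∀ t : Fin k → Fin (n + 1) × Fin (n + 1), MeasurableSet {y | ∀ l, P (t l) y} := fun t => by
    rw [Set.setOf_forall]
    exact MeasurableSet.iInter fun l => hPm (t l)
  have hmT : ∀ (a : Fin (n + 1)) (B : Finset (Fin (n + 1))), MeasurableSet {y | ∀ b ∈ B, P (a, b) y} := by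
    intro a B
    have hBeq : {y | ∀ b ∈ B, P (a, b) y} = ⋂ b ∈ B, {y | P (a, b) y} := by
      ext y
      simp only [Set.mem_setOf_eq, Set.mem_iInter]
    rw [hBeq]
    exact B.measurableSet_biInter fun b _ => hPm (a, b)
  have hm1 : ∀ t : Fin k → Fin (n + 1) × Fin (n + 1),
      Measurable fun y => (if ∀ l, P (t l) y then (1 : ℝ≥0∞) else 0) := fun t =>
    Measurable.ite (hmS t) measurable_const measurable_const
  have hm2 : ∀ (a : Fin (n + 1)) (B : Finset (Fin (n + 1))),
      Measurable fun y => (if ∀ b ∈ B, P (a, b) y then (1 : ℝ≥0∞) else 0) := fun a B =>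
    Measurable.ite (hmT a B) measurable_const measurable_const
  have hf₁ : Measurable fun y => ∑ t ∈ Td, (if ∀ l, P (t l) y then (1 : ℝ≥0∞) else 0) :=
    Finset.measurable_sum _ fun t _ => hm1 t
  have hg : ∀ a : Fin (n + 1), Measurable fun y =>
      ∑ B ∈ (Finset.univ.erase a).powersetCard k, (if ∀ b ∈ B, P (a, b) y then (1 : ℝ≥0∞) else 0) :=
    fun a => Finset.measurable_sum _ fun B _ => hm2 a B
  have hga : ∀ a : Fin (n + 1), Measurable fun y => (k : ℝ≥0∞) ^ k + (k : ℝ≥0∞) ^ k * (k.factorial : ℝ≥0∞) *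
      ∑ B ∈ (Finset.univ.erase a).powersetCard k, (if ∀ b ∈ B, P (a, b) y then (1 : ℝ≥0∞) else 0) :=
    fun a => measurable_const.add ((hg a).const_mul _)
  -- the integrals of the pieces
  have I1 : ∫⁻ y, ∑ t ∈ Td, (if ∀ l, P (t l) y then (1 : ℝ≥0∞) else 0) ∂G =
      ∑ t ∈ Td, G {y | ∀ l, P (t l) y} := by
    rw [lintegral_finsetSum _ fun t _ => hm1 t]
    exact Finset.sum_congr rfl fun t _ => lintegral_ite_eq_measure G (hmS t)
  have I2 : ∀ a : Fin (n + 1), ∫⁻ y, ((k : ℝ≥0∞) ^ k + (k : ℝ≥0∞) ^ k * (k.factorial : ℝ≥0∞) *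
      ∑ B ∈ (Finset.univ.erase a).powersetCard k, (if ∀ b ∈ B, P (a, b) y then (1 : ℝ≥0∞) else 0)) ∂G =
      (k : ℝ≥0∞) ^ k + (k : ℝ≥0∞) ^ k * (k.factorial : ℝ≥0∞) *
        ∑ B ∈ (Finset.univ.erase a).powersetCard k, G {y | ∀ b ∈ B, P (a, b) y} := by
    intro a
    rw [lintegral_add_left measurable_const, lintegral_const, measure_univ, mul_one,
      lintegral_const_mul _ (hg a), lintegral_finsetSum _ fun B _ => hm2 a B]
    congr 2
    exact Finset.sum_congr rfl fun B _ => lintegral_ite_eq_measure G (hmT a B)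
  -- cardinalities
  have hTd : (Td.card : ℝ≥0∞) ≤ (((n + 1) * (n + 1)) ^ k : ℕ) := by
    have h : Td.card ≤ ((n + 1) * (n + 1)) ^ k := by
      calc Td.card ≤ (Finset.univ : Finset (Fin k → Fin (n + 1) × Fin (n + 1))).card :=
            Finset.card_filter_le _ _
        _ = ((n + 1) * (n + 1)) ^ k := by
            rw [Finset.card_univ, Fintype.card_fun, Fintype.card_prod, Fintype.card_fin, Fintype.card_fin]
    exact_mod_cast h
  have hPB : ∀ a : Fin (n + 1), ((Finset.univ.erase a).powersetCard k).card = n.choose k := fun a => by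
    rw [Finset.card_powersetCard, Finset.card_erase_of_mem (Finset.mem_univ a), Finset.card_univ,
      Fintype.card_fin, Nat.add_sub_cancel]
  calc ∫⁻ y, (((Finset.univ.filter fun q => P q y).card ^ k : ℕ) : ℝ≥0∞) ∂G
      ≤ ∫⁻ y, (2 * ∑ t ∈ Td, (if ∀ l, P (t l) y then (1 : ℝ≥0∞) else 0) +
          (4 * (k : ℝ≥0∞) ^ 2) ^ k * ∑ a : Fin (n + 1), ((k : ℝ≥0∞) ^ k + (k : ℝ≥0∞) ^ k * (k.factorial : ℝ≥0∞) *
            ∑ B ∈ (Finset.univ.erase a).powersetCard k, if ∀ b ∈ B, P (a, b) y then (1 : ℝ≥0∞) else 0)) ∂G :=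
        lintegral_mono hpt
    _ = 2 * ∑ t ∈ Td, G {y | ∀ l, P (t l) y} +
          (4 * (k : ℝ≥0∞) ^ 2) ^ k * ∑ a : Fin (n + 1), ((k : ℝ≥0∞) ^ k + (k : ℝ≥0∞) ^ k * (k.factorial : ℝ≥0∞) *
            ∑ B ∈ (Finset.univ.erase a).powersetCard k, G {y | ∀ b ∈ B, P (a, b) y}) := by
        rw [lintegral_add_left (hf₁.const_mul _), lintegral_const_mul _ hf₁,
          lintegral_const_mul _ (Finset.measurable_sum _ fun a _ => hga a),
          lintegral_finsetSum _ fun a _ => hga a, I1]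
        congr 2
        exact Finset.sum_congr rfl fun a _ => I2 a
    _ ≤ 2 * ∑ _t ∈ Td, Mb +
          (4 * (k : ℝ≥0∞) ^ 2) ^ k * ∑ a : Fin (n + 1), ((k : ℝ≥0∞) ^ k + (k : ℝ≥0∞) ^ k * (k.factorial : ℝ≥0∞) *
            ∑ _B ∈ (Finset.univ.erase a).powersetCard k, Tb) := by
        gcongr with t ht a _ B hB
        · exact hM t (Finset.mem_filter.1 ht).2
        · exact hT a B hB
    _ ≤ _ := by
        simp only [Finset.sum_const, hPB, nsmul_eq_mul, Finset.card_univ, Fintype.card_fin]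
        have h2 : (k : ℝ≥0∞) ^ k + (k : ℝ≥0∞) ^ k * (k.factorial : ℝ≥0∞) * ((n.choose k : ℕ) * Tb) =
            (k : ℝ≥0∞) ^ k * (1 + (k.factorial : ℝ≥0∞) * (n.choose k : ℝ≥0∞) * Tb) := by ring
        rw [h2]
        gcongr

/-! ## The concrete events: one shell, a matching of shells -/

/-- The velocity shell of an ordered pair is a measurable event of configurations. [folklore] -/
theorem measurableSet_shell (N : ℕ) (ε δ : ℝ) (i j : Fin (N + 1)) :
    MeasurableSet {y : Config (N + 1) (Fin 3) T3 | ε ≤ ‖(Torus.geometry (Fin 3)).sepVec (y i).1 (y j).1‖ ∧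
      ‖(Torus.geometry (Fin 3)).sepVec (y i).1 (y j).1‖ ≤ ε + δ * ‖(y i).2 - (y j).2‖} := by
  have hd : Measurable fun y : Config (N + 1) (Fin 3) T3 =>
      ‖(Torus.geometry (Fin 3)).sepVec (y i).1 (y j).1‖ :=
    (Torus.measurable_geometry_sepVec.comp
      ((measurable_pi_apply i).fst.prodMk (measurable_pi_apply j).fst)).norm
  have hr : Measurable fun y : Config (N + 1) (Fin 3) T3 => ε + δ * ‖(y i).2 - (y j).2‖ :=
    measurable_const.add (((measurable_pi_apply i).snd.sub (measurable_pi_apply j).snd).norm.const_mul δ)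
  exact (measurableSet_le measurable_const hd).inter (measurableSet_le hd hr)


/-- **Gibbs probability of a matching of shells.**  For `k` ordered pairs `t l` with pairwise disjoint
label sets, the event that all of them are non-degenerate velocity shells depends only on the `≤ 2k`
particles of `t`, so by the insertion bound `localGibbsLaw_le_pow_mul_pi` a free-law bound
`U {shells of t} ≤ P^k` gives the Gibbs bound `4^k P^k` (the event is empty if some pair is
degenerate). [folklore] -/
theorem localGibbsLaw_matchingShells_le (b ϑ : ℝ) (w : V3) (hb : 0 < b) (hϑ : 0 < ϑ) (σ : ℝ)
    (hσ : 0 < σ) (hσ2 : σ < 1 / 2) (hlam : v₁ * σ ^ 3 ≤ 1 / 2) (N : ℕ)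
    (Φ : HardSphereFlow (Torus.geometry (Fin 3)) (hsDiameter σ N) (N + 1)) (δ : ℝ) {P : ℝ≥0∞} (k : ℕ)
    (hU : ∀ t : Fin k → Fin (N + 1) × Fin (N + 1), (∀ l, (t l).1 ≠ (t l).2) →
      (∀ l l', l ≠ l' → Disjoint ({(t l).1, (t l).2} : Finset (Fin (N + 1))) {(t l').1, (t l').2}) →
      Measure.pi (fun _ : Fin (N + 1) => (volume : Measure T3).prod (gaussMeasure w ϑ))
        {y : Config (N + 1) (Fin 3) T3 | ∀ l,
          hsDiameter σ N ≤ ‖(Torus.geometry (Fin 3)).sepVec (y (t l).1).1 (y (t l).2).1‖ ∧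
          ‖(Torus.geometry (Fin 3)).sepVec (y (t l).1).1 (y (t l).2).1‖ ≤
            hsDiameter σ N + δ * ‖(y (t l).1).2 - (y (t l).2).2‖} ≤ P ^ k)
    (t : Fin k → Fin (N + 1) × Fin (N + 1))
    (ht : ∀ l l', l ≠ l' → Disjoint ({(t l).1, (t l).2} : Finset (Fin (N + 1))) {(t l').1, (t l').2}) :
    localGibbsLaw σ (fun _ => b) (fun _ => w) (fun _ => ϑ) N Φ
      {y | ∀ l, (t l).1 ≠ (t l).2 ∧
          (hsDiameter σ N ≤ ‖(Torus.geometry (Fin 3)).sepVec (y (t l).1).1 (y (t l).2).1‖ ∧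
          ‖(Torus.geometry (Fin 3)).sepVec (y (t l).1).1 (y (t l).2).1‖ ≤
            hsDiameter σ N + δ * ‖(y (t l).1).2 - (y (t l).2).2‖)} ≤
      4 ^ k * P ^ k := by
  set S : Set (Config (N + 1) (Fin 3) T3) := {y | ∀ l, (t l).1 ≠ (t l).2 ∧
      (hsDiameter σ N ≤ ‖(Torus.geometry (Fin 3)).sepVec (y (t l).1).1 (y (t l).2).1‖ ∧
      ‖(Torus.geometry (Fin 3)).sepVec (y (t l).1).1 (y (t l).2).1‖ ≤
        hsDiameter σ N + δ * ‖(y (t l).1).2 - (y (t l).2).2‖)} with hSdef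
  by_cases hne : ∀ l, (t l).1 ≠ (t l).2
  · have hS : MeasurableSet S := by
      rw [hSdef, Set.setOf_forall]
      exact MeasurableSet.iInter fun l =>
        (MeasurableSet.const _).inter (measurableSet_shell N (hsDiameter σ N) δ (t l).1 (t l).2)
    set I := (Finset.univ : Finset (Fin k)).biUnion (fun l => ({(t l).1, (t l).2} : Finset (Fin (N + 1))))
      with hI
    have hIcard : I.card ≤ 2 * k := by
      calc I.card ≤ ∑ l : Fin k, ({(t l).1, (t l).2} : Finset (Fin (N + 1))).card := Finset.card_biUnion_le
        _ ≤ ∑ _l : Fin k, 2 := Finset.sum_le_sum (fun l _ => Finset.card_le_two)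
        _ = 2 * k := by
          rw [Finset.sum_const_nat (fun _ _ => rfl), Finset.card_univ, Fintype.card_fin, mul_comm]
    have hdet : ∀ y y' : Config (N + 1) (Fin 3) T3, (∀ i ∈ I, y i = y' i) → (y ∈ S ↔ y' ∈ S) := by
      intro y y' h
      have h1 : ∀ l, y (t l).1 = y' (t l).1 := fun l =>
        h _ (Finset.mem_biUnion.2 ⟨l, Finset.mem_univ _, Finset.mem_insert_self _ _⟩)
      have h2 : ∀ l, y (t l).2 = y' (t l).2 := fun l =>
        h _ (Finset.mem_biUnion.2 ⟨l, Finset.mem_univ _,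
          Finset.mem_insert_of_mem (Finset.mem_singleton_self _)⟩)
      simp only [hSdef, Set.mem_setOf_eq, h1, h2]
    have h4 : (2 : ℝ≥0∞) ^ 2 = 4 := by norm_num
    calc localGibbsLaw σ (fun _ => b) (fun _ => w) (fun _ => ϑ) N Φ S
        ≤ 2 ^ I.card * Measure.pi (fun _ : Fin (N + 1) => (volume : Measure T3).prod (gaussMeasure w ϑ)) S :=
          localGibbsLaw_le_pow_mul_pi b ϑ w hb hϑ σ hσ hσ2 hlam N Φ I S hS hdet
      _ ≤ 2 ^ (2 * k) * P ^ k :=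
          mul_le_mul' (pow_le_pow_right₀ one_le_two hIcard)
            ((measure_mono fun y hy l => (hy l).2).trans (hU t hne ht))
      _ = 4 ^ k * P ^ k := by rw [pow_mul, h4]
  · push Not at hne
    obtain ⟨l, hl⟩ := hne
    have h0 : S = ∅ := Set.eq_empty_iff_forall_notMem.2 fun y hy => (hy l).1 hl
    rw [h0, measure_empty]
    exact zero_le

end Summit.AtomisticToContinuum.HydrodynamicLimit.Theorems.LambertianContactSwapLambertianEulerShellCountMoments

end
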